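import Summits.ValiantsHypothesis.ValiantsHypothesis.Theorems.KPlusLogSqLawTridiagonalRealStaticUnitFive

/-!
# Route «KPlusLogSqLaw», crux `WeakLifting` (stmt-ValiantsHypothesis-19561) — REAL side of the tridiagonal sector:
# the UNIT-COEFFICIENT sub-sector at size `6` — the TWO-TRIANGLE GAUGE and the first SIGN-CHAMBER LAWS

HONEST FRAMING.  Helper theorems (`--supports stmt-ValiantsHypothesis-19561 --as helper`), seat val-sym-lift-p1 (g17), cell `pub-symmetroid`,
2026-08-28; sequel of `…UnitFive` / `…UnitFiveExact` (`U 5 = 4`) on the row `m = 6` of the unit-coefficient sub-sector of the α register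
(kernel floor `U 6 ≥ 4`, p613828).  Currency `StaticTridiagonalRealPotential.pathDet (fun _ => 1) d (fun _ => 1) f 6`; edge slopes
`L_t := 2f_t − d_t − d_{t+1} ∈ ℤ` (`t = 0,…,4`), `b_t = x^{L_t}`.  Proved here, for ALL exponent data:
* `eval_unit_six`, `eval_unit_six_eq` — the thirteen matchings of the path `P₆` and the **TWO-TRIANGLE GAUGE**
  `D₆(x) = x^E · ( (1 − b₀ − b₁)(1 − b₃ − b₄) − b₂(1 − b₀)(1 − b₄) )`: the two end `3 × 3` unit blocks against the middle link times the two
  end `2 × 2` blocks (`unit_six_root_eq`: at a positive zero `(1 − b₀ − b₁)(1 − b₃ − b₄) = b₂(1 − b₀)(1 − b₄)`); `D₆(1) = 1` (no resonance zero at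
  size `6`).
* **ONE-SIDED LAWS** (`unit_six_no_root_gt_one_of_…`, `…_lt_one_of_…`): no zero in `(1, ∞)` when `L₀ > 0, L₄ > 0, L₂ < 0`, or when
  `L₀ > 0, L₄ < 0, L₃ > 0`, or when `L₄ > 0, L₀ < 0, L₁ > 0`; mirror statements on `(0, 1)` (all by comparing the two triangles with the two
  `2 × 2` blocks — no division, no calculus).
* **EMPTY CHAMBER** (`card_posRoots_unit_six_eq_zero_of_alternatingOuterPairs`): if `sign L₀ = sign L₃ = −sign L₁ = −sign L₄` (slope signs
  `+ − ? + −` or `− + ? − +`, any middle slope) the design has NO positive determinant zero at all.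
* **EXACTLY-ONE CHAMBER** (`card_posRoots_unit_six_eq_one_of_dip`): if `L₀, L₁, L₃, L₄ > 0 > L₂` (signs `+ + − + +`) the design has EXACTLY ONE
  positive zero; it lies in `(1/5, 1)` (existence by the intermediate value theorem from `D₆(1/5) < 0 < D₆(1)`, uniqueness by the strict
  monotonicity of the two secular factors `b₁/(1 − b₀) − 1`, `b₃/(1 − b₄) − 1` and of `b₂`).
LOCATED CONTEXT (this seat, not claimed in the kernel): over the ten sign classes of `(L₀,…,L₄)` modulo reversal and `x ↦ 1/x`, a log-grid
census (22⁴ slope ratios up to 2500 per class) and ≈ 10⁶ multi-scale / near-resonant integer designs found no unit `6`-design with five positive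
zeros (`U 6 ≥ 4` stands; the two chambers above read `0` and `1` identically on the grid, as proved here).  Nothing here is an upper law for the
register (α NO MOVER); nothing bears on `WeakLifting` / `TropicalB` (stmt-19771) in their windows, Conjecture B, the Door-A registers,
`MatrixDescartes` (stmt-18050) or VP ≠ VNP.
[this seat; folklore: continuants ↔ matchings of the path, intermediate value theorem]
-/

-- `Summit.ValiantsHypothesis.ValiantsHypothesis.…` repeats a component by the D-0017 layout (single-conjunct summit); the name is mandated.
set_option linter.dupNamespace false
set_option autoImplicit false

namespace Summit.ValiantsHypothesis.ValiantsHypothesis.Theorems.KPlusLogSqLaw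
namespace StaticTridiagonalRealUnit

open Polynomial Finset
open Summit.ValiantsHypothesis.ValiantsHypothesis.Theorems.KPlusLogSqLaw.StaticTridiagonalRealPotential
  (pathDet pathDet_zero pathDet_one pathDet_add_two)

variable (d : ℕ → ℕ) (f : ℕ → ℕ)

/-! ### The unit `6 × 6` determinant and the two-triangle gauge -/

/-- the unit `6 × 6` determinant: the thirteen matchings of the path on six vertices. [folklore] -/
theorem eval_unit_six (x : ℝ) :
    (pathDet (fun _ => (1 : ℝ)) d (fun _ => (1 : ℝ)) f 6).eval x =
      x ^ (d 0 + d 1 + d 2 + d 3 + d 4 + d 5)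
        - x ^ (2 * f 0 + d 2 + d 3 + d 4 + d 5) - x ^ (d 0 + 2 * f 1 + d 3 + d 4 + d 5) - x ^ (d 0 + d 1 + 2 * f 2 + d 4 + d 5)
        - x ^ (d 0 + d 1 + d 2 + 2 * f 3 + d 5) - x ^ (d 0 + d 1 + d 2 + d 3 + 2 * f 4)
        + x ^ (2 * f 0 + 2 * f 2 + d 4 + d 5) + x ^ (2 * f 0 + d 2 + 2 * f 3 + d 5) + x ^ (2 * f 0 + d 2 + d 3 + 2 * f 4)
        + x ^ (d 0 + 2 * f 1 + 2 * f 3 + d 5) + x ^ (d 0 + 2 * f 1 + d 3 + 2 * f 4) + x ^ (d 0 + d 1 + 2 * f 2 + 2 * f 4)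
        - x ^ (2 * f 0 + 2 * f 2 + 2 * f 4) := by
  have e5 := eval_unit_five d f x
  have e4 := eval_unit_four d f x
  rw [show (6 : ℕ) = 4 + 2 from rfl, pathDet_add_two]
  simp only [eval_sub, eval_mul, eval_pow, eval_C, eval_X, one_mul]
  rw [show (4 : ℕ) + 1 = 5 from rfl, e5, e4]
  ring

/-- `D₆(1) = 1`: size `6` carries no resonance zero. [folklore] -/
theorem eval_unit_six_one : (pathDet (fun _ => (1 : ℝ)) d (fun _ => (1 : ℝ)) f 6).eval 1 = 1 := by
  rw [eval_unit_six]; simp only [one_pow]; ring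

/-- the unit `6 × 6` determinant is not the zero polynomial. -/
theorem unit_six_ne_zero : pathDet (fun _ => (1 : ℝ)) d (fun _ => (1 : ℝ)) f 6 ≠ 0 := by
  intro h
  have h1 := eval_unit_six_one d f
  rw [h, eval_zero] at h1
  exact zero_ne_one h1

/-- **two-triangle gauge** at `x ≠ 0`: `D₆(x) = x^{E} · ((1 − b₀ − b₁)(1 − b₃ − b₄) − b₂(1 − b₀)(1 − b₄))`, `b_t = x^{L_t}`,
`L_t = 2f_t − d_t − d_{t+1}`, `E = Σ d_t`. [this file] -/
theorem eval_unit_six_eq (x : ℝ) (hx : x ≠ 0) :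
    (pathDet (fun _ => (1 : ℝ)) d (fun _ => (1 : ℝ)) f 6).eval x =
      x ^ (d 0 + d 1 + d 2 + d 3 + d 4 + d 5) *
        ((1 - x ^ ((2 * f 0 : ℤ) - d 0 - d 1) - x ^ ((2 * f 1 : ℤ) - d 1 - d 2)) *
            (1 - x ^ ((2 * f 3 : ℤ) - d 3 - d 4) - x ^ ((2 * f 4 : ℤ) - d 4 - d 5)) -
          x ^ ((2 * f 2 : ℤ) - d 2 - d 3) * (1 - x ^ ((2 * f 0 : ℤ) - d 0 - d 1)) * (1 - x ^ ((2 * f 4 : ℤ) - d 4 - d 5))) := by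
  have e0 := pow_eq_pow_mul_zpow hx (p := 2 * f 0 + d 2 + d 3 + d 4 + d 5) (E := d 0 + d 1 + d 2 + d 3 + d 4 + d 5)
    (L := (2 * f 0 : ℤ) - d 0 - d 1) (by push_cast; ring)
  have e1 := pow_eq_pow_mul_zpow hx (p := d 0 + 2 * f 1 + d 3 + d 4 + d 5) (E := d 0 + d 1 + d 2 + d 3 + d 4 + d 5)
    (L := (2 * f 1 : ℤ) - d 1 - d 2) (by push_cast; ring)
  have e2 := pow_eq_pow_mul_zpow hx (p := d 0 + d 1 + 2 * f 2 + d 4 + d 5) (E := d 0 + d 1 + d 2 + d 3 + d 4 + d 5)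
    (L := (2 * f 2 : ℤ) - d 2 - d 3) (by push_cast; ring)
  have e3 := pow_eq_pow_mul_zpow hx (p := d 0 + d 1 + d 2 + 2 * f 3 + d 5) (E := d 0 + d 1 + d 2 + d 3 + d 4 + d 5)
    (L := (2 * f 3 : ℤ) - d 3 - d 4) (by push_cast; ring)
  have e4 := pow_eq_pow_mul_zpow hx (p := d 0 + d 1 + d 2 + d 3 + 2 * f 4) (E := d 0 + d 1 + d 2 + d 3 + d 4 + d 5)
    (L := (2 * f 4 : ℤ) - d 4 - d 5) (by push_cast; ring)
  have e02 := pow_eq_pow_mul_zpow hx (p := 2 * f 0 + 2 * f 2 + d 4 + d 5) (E := d 0 + d 1 + d 2 + d 3 + d 4 + d 5)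
    (L := ((2 * f 0 : ℤ) - d 0 - d 1) + ((2 * f 2 : ℤ) - d 2 - d 3)) (by push_cast; ring)
  have e03 := pow_eq_pow_mul_zpow hx (p := 2 * f 0 + d 2 + 2 * f 3 + d 5) (E := d 0 + d 1 + d 2 + d 3 + d 4 + d 5)
    (L := ((2 * f 0 : ℤ) - d 0 - d 1) + ((2 * f 3 : ℤ) - d 3 - d 4)) (by push_cast; ring)
  have e04 := pow_eq_pow_mul_zpow hx (p := 2 * f 0 + d 2 + d 3 + 2 * f 4) (E := d 0 + d 1 + d 2 + d 3 + d 4 + d 5)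
    (L := ((2 * f 0 : ℤ) - d 0 - d 1) + ((2 * f 4 : ℤ) - d 4 - d 5)) (by push_cast; ring)
  have e13 := pow_eq_pow_mul_zpow hx (p := d 0 + 2 * f 1 + 2 * f 3 + d 5) (E := d 0 + d 1 + d 2 + d 3 + d 4 + d 5)
    (L := ((2 * f 1 : ℤ) - d 1 - d 2) + ((2 * f 3 : ℤ) - d 3 - d 4)) (by push_cast; ring)
  have e14 := pow_eq_pow_mul_zpow hx (p := d 0 + 2 * f 1 + d 3 + 2 * f 4) (E := d 0 + d 1 + d 2 + d 3 + d 4 + d 5)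
    (L := ((2 * f 1 : ℤ) - d 1 - d 2) + ((2 * f 4 : ℤ) - d 4 - d 5)) (by push_cast; ring)
  have e24 := pow_eq_pow_mul_zpow hx (p := d 0 + d 1 + 2 * f 2 + 2 * f 4) (E := d 0 + d 1 + d 2 + d 3 + d 4 + d 5)
    (L := ((2 * f 2 : ℤ) - d 2 - d 3) + ((2 * f 4 : ℤ) - d 4 - d 5)) (by push_cast; ring)
  have e024 := pow_eq_pow_mul_zpow hx (p := 2 * f 0 + 2 * f 2 + 2 * f 4) (E := d 0 + d 1 + d 2 + d 3 + d 4 + d 5)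
    (L := ((2 * f 0 : ℤ) - d 0 - d 1) + ((2 * f 2 : ℤ) - d 2 - d 3) + ((2 * f 4 : ℤ) - d 4 - d 5)) (by push_cast; ring)
  rw [eval_unit_six, e0, e1, e2, e3, e4, e02, e03, e04, e13, e14, e24, e024, zpow_add₀ hx, zpow_add₀ hx, zpow_add₀ hx,
    zpow_add₀ hx, zpow_add₀ hx, zpow_add₀ hx, zpow_add₀ hx, zpow_add₀ hx]
  ring

/-- at a positive zero the two triangles balance the middle link against the two end `2 × 2` blocks:
`(1 − b₀ − b₁)(1 − b₃ − b₄) = b₂(1 − b₀)(1 − b₄)`. [this file] -/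
theorem unit_six_root_eq {x : ℝ} (hx : 0 < x)
    (h : (pathDet (fun _ => (1 : ℝ)) d (fun _ => (1 : ℝ)) f 6).eval x = 0) :
    (1 - x ^ ((2 * f 0 : ℤ) - d 0 - d 1) - x ^ ((2 * f 1 : ℤ) - d 1 - d 2)) *
        (1 - x ^ ((2 * f 3 : ℤ) - d 3 - d 4) - x ^ ((2 * f 4 : ℤ) - d 4 - d 5)) =
      x ^ ((2 * f 2 : ℤ) - d 2 - d 3) * (1 - x ^ ((2 * f 0 : ℤ) - d 0 - d 1)) * (1 - x ^ ((2 * f 4 : ℤ) - d 4 - d 5)) := by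
  rw [eval_unit_six_eq d f x hx.ne'] at h
  rcases mul_eq_zero.1 h with h1 | h1
  · exact absurd h1 (pow_ne_zero _ hx.ne')
  · linarith

/-! ### One-sided laws: slope signs that empty one side of `x = 1`

In the two-triangle gauge write `C = 1 − b₀`, `D = 1 − b₄`, `A = C − b₁`, `B = D − b₃`; the root equation is `A·B = b₂·C·D`.  Each law below is a
strict inequality `A·B > b₂·C·D` on one side, obtained by comparing signs and sizes of the four factors. -/

/-- `x > 1`, `L₀ > 0`, `L₄ > 0`, `L₂ < 0`: then `A < C < 0`, `B < D < 0`, so `AB > CD > b₂CD`. [this file] -/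
theorem unit_six_lhs_gt_of_gt_one_a (L₀ L₁ L₂ L₃ L₄ : ℤ) (h0 : 0 < L₀) (h4 : 0 < L₄) (h2 : L₂ < 0) {x : ℝ} (hx : 1 < x) :
    x ^ L₂ * (1 - x ^ L₀) * (1 - x ^ L₄) < (1 - x ^ L₀ - x ^ L₁) * (1 - x ^ L₃ - x ^ L₄) := by
  have hx0 : 0 < x := one_pos.trans hx
  have c0 : 1 - x ^ L₀ < 0 := by linarith [one_lt_zpow₀ hx h0]
  have c4 : 1 - x ^ L₄ < 0 := by linarith [one_lt_zpow₀ hx h4]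
  have b1 := zpow_pos hx0 L₁
  have b3 := zpow_pos hx0 L₃
  have b2 : x ^ L₂ < 1 := zpow_lt_one_of_neg₀ hx h2
  have hCD : 0 < (1 - x ^ L₀) * (1 - x ^ L₄) := mul_pos_of_neg_of_neg c0 c4
  nlinarith [mul_pos b1 b3, mul_pos b1 (neg_pos.2 c4), mul_pos b3 (neg_pos.2 c0), mul_lt_mul_of_pos_right b2 hCD]

/-- `x > 1`, `L₀ > 0`, `L₄ < 0`, `L₃ > 0`: then `A < 0`, `B < 0`, `CD < 0`, so `AB > 0 > b₂CD`. [this file] -/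
theorem unit_six_lhs_gt_of_gt_one_b (L₀ L₁ L₂ L₃ L₄ : ℤ) (h0 : 0 < L₀) (h4 : L₄ < 0) (h3 : 0 < L₃) {x : ℝ} (hx : 1 < x) :
    x ^ L₂ * (1 - x ^ L₀) * (1 - x ^ L₄) < (1 - x ^ L₀ - x ^ L₁) * (1 - x ^ L₃ - x ^ L₄) := by
  have hx0 : 0 < x := one_pos.trans hx
  have c0 : 1 - x ^ L₀ < 0 := by linarith [one_lt_zpow₀ hx h0]
  have c4 : 0 < 1 - x ^ L₄ := by linarith [zpow_lt_one_of_neg₀ hx h4]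
  have hA : 1 - x ^ L₀ - x ^ L₁ < 0 := by linarith [zpow_pos hx0 L₁]
  have hB : 1 - x ^ L₃ - x ^ L₄ < 0 := by linarith [one_lt_zpow₀ hx h3, zpow_pos hx0 L₄]
  have hCD : x ^ L₂ * (1 - x ^ L₀) * (1 - x ^ L₄) < 0 :=
    mul_neg_of_neg_of_pos (mul_neg_of_pos_of_neg (zpow_pos hx0 L₂) c0) c4
  exact hCD.trans (mul_pos_of_neg_of_neg hA hB)

/-- `x > 1`, `L₄ > 0`, `L₀ < 0`, `L₁ > 0` (the reversal of the previous law). [this file] -/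
theorem unit_six_lhs_gt_of_gt_one_c (L₀ L₁ L₂ L₃ L₄ : ℤ) (h4 : 0 < L₄) (h0 : L₀ < 0) (h1 : 0 < L₁) {x : ℝ} (hx : 1 < x) :
    x ^ L₂ * (1 - x ^ L₀) * (1 - x ^ L₄) < (1 - x ^ L₀ - x ^ L₁) * (1 - x ^ L₃ - x ^ L₄) := by
  have h := unit_six_lhs_gt_of_gt_one_b L₄ L₃ L₂ L₁ L₀ h4 h0 h1 hx
  linarith

/-- transport `x ↦ x⁻¹`: the root-equation data at `x < 1` for slopes `L` are the data at `x⁻¹ > 1` for slopes `−L`. -/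
theorem unit_six_inv_aux (L : ℤ) {x : ℝ} : x⁻¹ ^ (-L) = x ^ L := by rw [inv_zpow', neg_neg]

/-- `x < 1`, `L₀ < 0`, `L₄ < 0`, `L₂ > 0`: no zero (mirror of law `a`). [this file] -/
theorem unit_six_lhs_gt_of_lt_one_a (L₀ L₁ L₂ L₃ L₄ : ℤ) (h0 : L₀ < 0) (h4 : L₄ < 0) (h2 : 0 < L₂) {x : ℝ} (hx0 : 0 < x) (hx : x < 1) :
    x ^ L₂ * (1 - x ^ L₀) * (1 - x ^ L₄) < (1 - x ^ L₀ - x ^ L₁) * (1 - x ^ L₃ - x ^ L₄) := by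
  have h := unit_six_lhs_gt_of_gt_one_a (-L₀) (-L₁) (-L₂) (-L₃) (-L₄) (by omega) (by omega) (by omega) ((one_lt_inv₀ hx0).2 hx)
  simp only [unit_six_inv_aux] at h
  exact h

/-- `x < 1`, `L₀ < 0`, `L₄ > 0`, `L₃ < 0`: no zero (mirror of law `b`). [this file] -/
theorem unit_six_lhs_gt_of_lt_one_b (L₀ L₁ L₂ L₃ L₄ : ℤ) (h0 : L₀ < 0) (h4 : 0 < L₄) (h3 : L₃ < 0) {x : ℝ} (hx0 : 0 < x) (hx : x < 1) :
    x ^ L₂ * (1 - x ^ L₀) * (1 - x ^ L₄) < (1 - x ^ L₀ - x ^ L₁) * (1 - x ^ L₃ - x ^ L₄) := by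
  have h := unit_six_lhs_gt_of_gt_one_b (-L₀) (-L₁) (-L₂) (-L₃) (-L₄) (by omega) (by omega) (by omega) ((one_lt_inv₀ hx0).2 hx)
  simp only [unit_six_inv_aux] at h
  exact h

/-- `x < 1`, `L₄ < 0`, `L₀ > 0`, `L₁ < 0`: no zero (mirror of law `c`). [this file] -/
theorem unit_six_lhs_gt_of_lt_one_c (L₀ L₁ L₂ L₃ L₄ : ℤ) (h4 : L₄ < 0) (h0 : 0 < L₀) (h1 : L₁ < 0) {x : ℝ} (hx0 : 0 < x) (hx : x < 1) :
    x ^ L₂ * (1 - x ^ L₀) * (1 - x ^ L₄) < (1 - x ^ L₀ - x ^ L₁) * (1 - x ^ L₃ - x ^ L₄) := by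
  have h := unit_six_lhs_gt_of_gt_one_c (-L₀) (-L₁) (-L₂) (-L₃) (-L₄) (by omega) (by omega) (by omega) ((one_lt_inv₀ hx0).2 hx)
  simp only [unit_six_inv_aux] at h
  exact h

/-- bookkeeping: membership in the positive-root set of `D₆`. -/
theorem mem_posRoots_unit_six {x : ℝ}
    (hx : x ∈ (pathDet (fun _ => (1 : ℝ)) d (fun _ => (1 : ℝ)) f 6).roots.toFinset.filter (fun x => 0 < x)) :
    0 < x ∧ (pathDet (fun _ => (1 : ℝ)) d (fun _ => (1 : ℝ)) f 6).eval x = 0 := by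
  simp only [Finset.mem_filter, Multiset.mem_toFinset, mem_roots', IsRoot.def] at hx
  exact ⟨hx.2, hx.1.2⟩

/-- **ONE-SIDED LAW**: `L₀ > 0`, `L₄ > 0`, `L₂ < 0` ⇒ every positive zero lies in `(0, 1)`. [this file] -/
theorem unit_six_root_lt_one_of_outer_pos_middle_neg
    (h0 : 0 < (2 * f 0 : ℤ) - d 0 - d 1) (h4 : 0 < (2 * f 4 : ℤ) - d 4 - d 5) (h2 : (2 * f 2 : ℤ) - d 2 - d 3 < 0)
    {x : ℝ} (hx : 0 < x) (hr : (pathDet (fun _ => (1 : ℝ)) d (fun _ => (1 : ℝ)) f 6).eval x = 0) : x < 1 := by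
  rcases lt_trichotomy x 1 with h | h | h
  · exact h
  · subst h; rw [eval_unit_six_one] at hr; exact absurd hr one_ne_zero
  · exact absurd (unit_six_root_eq d f hx hr) (unit_six_lhs_gt_of_gt_one_a _ _ _ _ _ h0 h4 h2 h).ne'

/-! ### The empty chamber -/

/-- **EMPTY CHAMBER.**  If the slope signs satisfy `sign L₀ = sign L₃ = −sign L₁ = −sign L₄` (patterns `+ − ? + −` and `− + ? − +`, any middle
slope `L₂`), the unit `6 × 6` design has NO positive determinant zero. [this file] -/
theorem card_posRoots_unit_six_eq_zero_of_alternatingOuterPairs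
    (h : (0 < (2 * f 0 : ℤ) - d 0 - d 1 ∧ (2 * f 1 : ℤ) - d 1 - d 2 < 0 ∧ 0 < (2 * f 3 : ℤ) - d 3 - d 4 ∧ (2 * f 4 : ℤ) - d 4 - d 5 < 0) ∨
      ((2 * f 0 : ℤ) - d 0 - d 1 < 0 ∧ 0 < (2 * f 1 : ℤ) - d 1 - d 2 ∧ (2 * f 3 : ℤ) - d 3 - d 4 < 0 ∧ 0 < (2 * f 4 : ℤ) - d 4 - d 5)) :
    ((pathDet (fun _ => (1 : ℝ)) d (fun _ => (1 : ℝ)) f 6).roots.toFinset.filter (fun x => 0 < x)).card = 0 := by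
  rw [Finset.card_eq_zero, Finset.eq_empty_iff_forall_notMem]
  intro x hx
  obtain ⟨hx0, hr⟩ := mem_posRoots_unit_six d f hx
  have heq := unit_six_root_eq d f hx0 hr
  rcases lt_trichotomy x 1 with hlt | heq1 | hgt
  · rcases h with ⟨a0, a1, _, a4⟩ | ⟨a0, _, a3, a4⟩
    · exact absurd heq (unit_six_lhs_gt_of_lt_one_c _ _ _ _ _ a4 a0 a1 hx0 hlt).ne'
    · exact absurd heq (unit_six_lhs_gt_of_lt_one_b _ _ _ _ _ a0 a4 a3 hx0 hlt).ne'
  · subst heq1; rw [eval_unit_six_one] at hr; exact one_ne_zero hr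
  · rcases h with ⟨a0, _, a3, a4⟩ | ⟨a0, a1, _, a4⟩
    · exact absurd heq (unit_six_lhs_gt_of_gt_one_b _ _ _ _ _ a0 a4 a3 hgt).ne'
    · exact absurd heq (unit_six_lhs_gt_of_gt_one_c _ _ _ _ _ a4 a0 a1 hgt).ne'

/-! ### The exactly-one chamber `+ + − + +` -/

/-- in the chamber `L₀, L₁, L₃, L₄ > 0 > L₂`, two distinct zeros in `(0, 1)` are impossible: at a zero both triangles are negative, and the secular
factors `b₁/(1 − b₀)`, `b₃/(1 − b₄)` increase strictly while `b₂` decreases strictly. [this file] -/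
theorem unit_six_dip_aux (L₀ L₁ L₂ L₃ L₄ : ℤ) (h0 : 0 < L₀) (h1 : 0 < L₁) (h2 : L₂ < 0) (h3 : 0 < L₃) (h4 : 0 < L₄)
    {x y : ℝ} (hx : 0 < x) (hxy : x < y) (hy : y < 1)
    (hxr : (1 - x ^ L₀ - x ^ L₁) * (1 - x ^ L₃ - x ^ L₄) = x ^ L₂ * (1 - x ^ L₀) * (1 - x ^ L₄))
    (hyr : (1 - y ^ L₀ - y ^ L₁) * (1 - y ^ L₃ - y ^ L₄) = y ^ L₂ * (1 - y ^ L₀) * (1 - y ^ L₄)) : False := by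
  have hy0 : 0 < y := hx.trans hxy
  have hx1 : x < 1 := hxy.trans hy
  -- the four blocks at a point `z ∈ (0,1)`: `C, D ∈ (0,1)`, `b₁, b₃ ∈ (0,1)`, `b₂ > 1`; a zero forces `A < 0` and `B < 0`
  have neg : ∀ z : ℝ, 0 < z → z < 1 →
      (1 - z ^ L₀ - z ^ L₁) * (1 - z ^ L₃ - z ^ L₄) = z ^ L₂ * (1 - z ^ L₀) * (1 - z ^ L₄) →
      1 - z ^ L₀ - z ^ L₁ < 0 ∧ 1 - z ^ L₃ - z ^ L₄ < 0 := by
    intro z hz0 hz1 h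
    have c0 : 0 < 1 - z ^ L₀ := sub_pos.2 (zpow_lt_one₀ hz0 hz1 h0)
    have c4 : 0 < 1 - z ^ L₄ := sub_pos.2 (zpow_lt_one₀ hz0 hz1 h4)
    have b1 := zpow_pos hz0 L₁
    have b3 := zpow_pos hz0 L₃
    have b2 : 1 < z ^ L₂ := one_lt_zpow_of_neg₀ hz0 hz1 h2
    have hCD : 0 < (1 - z ^ L₀) * (1 - z ^ L₄) := mul_pos c0 c4
    have key : (1 - z ^ L₀) * (1 - z ^ L₄) < z ^ L₂ * (1 - z ^ L₀) * (1 - z ^ L₄) := by nlinarith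
    have hRpos : 0 < z ^ L₂ * (1 - z ^ L₀) * (1 - z ^ L₄) := mul_pos (mul_pos (zpow_pos hz0 L₂) c0) c4
    have hAC : 1 - z ^ L₀ - z ^ L₁ ≤ 1 - z ^ L₀ := by linarith
    have hBD : 1 - z ^ L₃ - z ^ L₄ ≤ 1 - z ^ L₄ := by linarith
    by_contra hAB
    rw [not_and_or, not_lt, not_lt] at hAB
    rcases hAB with hA | hB
    · rcases le_or_gt 0 (1 - z ^ L₃ - z ^ L₄) with hB | hB
      · nlinarith [mul_le_mul_of_nonneg_right hAC hB, mul_le_mul_of_nonneg_left hBD c0.le]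
      · nlinarith [mul_nonpos_of_nonneg_of_nonpos hA hB.le]
    · rcases le_or_gt 0 (1 - z ^ L₀ - z ^ L₁) with hA | hA
      · nlinarith [mul_le_mul_of_nonneg_right hAC hB, mul_le_mul_of_nonneg_left hBD c0.le]
      · nlinarith [mul_nonpos_of_nonneg_of_nonpos hB hA.le]
  obtain ⟨hAx, hBx⟩ := neg x hx hx1 hxr
  obtain ⟨hAy, hBy⟩ := neg y hy0 hy hyr
  have cx0 : 0 < 1 - x ^ L₀ := sub_pos.2 (zpow_lt_one₀ hx hx1 h0)
  have cx4 : 0 < 1 - x ^ L₄ := sub_pos.2 (zpow_lt_one₀ hx hx1 h4)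
  have cy0 : 0 < 1 - y ^ L₀ := sub_pos.2 (zpow_lt_one₀ hy0 hy h0)
  have cy4 : 0 < 1 - y ^ L₄ := sub_pos.2 (zpow_lt_one₀ hy0 hy h4)
  -- secular form: `(b₁/C − 1)(b₃/D − 1) = b₂`
  have sec : ∀ z : ℝ, 0 < 1 - z ^ L₀ → 0 < 1 - z ^ L₄ →
      (1 - z ^ L₀ - z ^ L₁) * (1 - z ^ L₃ - z ^ L₄) = z ^ L₂ * (1 - z ^ L₀) * (1 - z ^ L₄) →
      (z ^ L₁ / (1 - z ^ L₀) - 1) * (z ^ L₃ / (1 - z ^ L₄) - 1) = z ^ L₂ := by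
    intro z hz0 hz4 h
    field_simp
    linarith
  have fx := sec x cx0 cx4 hxr
  have fy := sec y cy0 cy4 hyr
  -- the secular factors are positive at a zero and strictly increasing in `z`; `b₂` is strictly decreasing
  have px : 0 < x ^ L₁ / (1 - x ^ L₀) - 1 := by
    rw [sub_pos, lt_div_iff₀ cx0]; linarith
  have qx : 0 < x ^ L₃ / (1 - x ^ L₄) - 1 := by
    rw [sub_pos, lt_div_iff₀ cx4]; linarith
  have m1 : x ^ L₁ / (1 - x ^ L₀) - 1 < y ^ L₁ / (1 - y ^ L₀) - 1 := by
    have e1 : x ^ L₁ < y ^ L₁ := zpow_lt_zpow_left₀ h1 hx.le hxy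
    have e0 : x ^ L₀ < y ^ L₀ := zpow_lt_zpow_left₀ h0 hx.le hxy
    have s1 : x ^ L₁ / (1 - x ^ L₀) < y ^ L₁ / (1 - x ^ L₀) := div_lt_div_of_pos_right e1 cx0
    have s2 : y ^ L₁ / (1 - x ^ L₀) ≤ y ^ L₁ / (1 - y ^ L₀) :=
      div_le_div_of_nonneg_left (zpow_pos hy0 _).le cy0 (by linarith)
    linarith
  have m3 : x ^ L₃ / (1 - x ^ L₄) - 1 < y ^ L₃ / (1 - y ^ L₄) - 1 := by
    have e3 : x ^ L₃ < y ^ L₃ := zpow_lt_zpow_left₀ h3 hx.le hxy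
    have e4 : x ^ L₄ < y ^ L₄ := zpow_lt_zpow_left₀ h4 hx.le hxy
    have s1 : x ^ L₃ / (1 - x ^ L₄) < y ^ L₃ / (1 - x ^ L₄) := div_lt_div_of_pos_right e3 cx4
    have s2 : y ^ L₃ / (1 - x ^ L₄) ≤ y ^ L₃ / (1 - y ^ L₄) :=
      div_le_div_of_nonneg_left (zpow_pos hy0 _).le cy4 (by linarith)
    linarith
  have m2 : y ^ L₂ < x ^ L₂ := zpow_lt_zpow_left_of_neg h2 hx hxy
  have prod : (x ^ L₁ / (1 - x ^ L₀) - 1) * (x ^ L₃ / (1 - x ^ L₄) - 1) <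
      (y ^ L₁ / (1 - y ^ L₀) - 1) * (y ^ L₃ / (1 - y ^ L₄) - 1) :=
    mul_lt_mul'' m1 m3 px.le qx.le
  rw [fx, fy] at prod
  exact lt_asymm prod m2

/-- in the chamber `L₀, L₁, L₃, L₄ > 0 > L₂` the determinant is NEGATIVE at `x = 1/5` (uniformly in the exponents: `A, B ∈ [3/5, 1)`,
`C, D ≥ 4/5`, `b₂ ≥ 5`). [this file] -/
theorem unit_six_dip_eval_fifth_neg
    (h0 : 0 < (2 * f 0 : ℤ) - d 0 - d 1) (h1 : 0 < (2 * f 1 : ℤ) - d 1 - d 2) (h2 : (2 * f 2 : ℤ) - d 2 - d 3 < 0)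
    (h3 : 0 < (2 * f 3 : ℤ) - d 3 - d 4) (h4 : 0 < (2 * f 4 : ℤ) - d 4 - d 5) :
    (pathDet (fun _ => (1 : ℝ)) d (fun _ => (1 : ℝ)) f 6).eval (1 / 5) < 0 := by
  have hq : (1 / 5 : ℝ) ≠ 0 := by norm_num
  have hq0 : (0 : ℝ) < 1 / 5 := by norm_num
  have hq1 : (1 / 5 : ℝ) ≤ 1 := by norm_num
  rw [eval_unit_six_eq d f _ hq]
  set L₀ := (2 * f 0 : ℤ) - d 0 - d 1
  set L₁ := (2 * f 1 : ℤ) - d 1 - d 2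
  set L₂ := (2 * f 2 : ℤ) - d 2 - d 3
  set L₃ := (2 * f 3 : ℤ) - d 3 - d 4
  set L₄ := (2 * f 4 : ℤ) - d 4 - d 5
  -- integer slopes: `b_t ≤ 1/5` for `L_t ≥ 1`, `b₂ ≥ 5` for `L₂ ≤ −1`
  have le5 : ∀ L : ℤ, 0 < L → (1 / 5 : ℝ) ^ L ≤ 1 / 5 := fun L hL => by
    have := zpow_le_zpow_right_of_le_one₀ hq0 hq1 (show (1 : ℤ) ≤ L by omega)
    rwa [zpow_one] at this
  have b0 := le5 L₀ h0
  have b1 := le5 L₁ h1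
  have b3 := le5 L₃ h3
  have b4 := le5 L₄ h4
  have p0 := zpow_pos hq0 L₀
  have p1 := zpow_pos hq0 L₁
  have p3 := zpow_pos hq0 L₃
  have p4 := zpow_pos hq0 L₄
  have b2 : (5 : ℝ) ≤ (1 / 5 : ℝ) ^ L₂ := by
    have h5 := zpow_le_zpow_right_of_le_one₀ hq0 hq1 (show L₂ ≤ -1 by omega)
    have e5 : ((1 / 5 : ℝ)) ^ (-1 : ℤ) = 5 := by norm_num
    rwa [e5] at h5
  have hE : (0 : ℝ) < (1 / 5 : ℝ) ^ (d 0 + d 1 + d 2 + d 3 + d 4 + d 5) := pow_pos hq0 _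
  apply mul_neg_of_pos_of_neg hE
  have hA1 : 1 - (1 / 5 : ℝ) ^ L₀ - (1 / 5 : ℝ) ^ L₁ < 1 := by linarith
  have hA0 : 0 < 1 - (1 / 5 : ℝ) ^ L₀ - (1 / 5 : ℝ) ^ L₁ := by linarith
  have hB1 : 1 - (1 / 5 : ℝ) ^ L₃ - (1 / 5 : ℝ) ^ L₄ ≤ 1 := by linarith
  have hB0 : 0 < 1 - (1 / 5 : ℝ) ^ L₃ - (1 / 5 : ℝ) ^ L₄ := by linarith
  have hC : 4 / 5 ≤ 1 - (1 / 5 : ℝ) ^ L₀ := by linarith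
  have hD : 4 / 5 ≤ 1 - (1 / 5 : ℝ) ^ L₄ := by linarith
  have hAB : (1 - (1 / 5 : ℝ) ^ L₀ - (1 / 5 : ℝ) ^ L₁) * (1 - (1 / 5 : ℝ) ^ L₃ - (1 / 5 : ℝ) ^ L₄) < 1 := by
    calc (1 - (1 / 5 : ℝ) ^ L₀ - (1 / 5 : ℝ) ^ L₁) * (1 - (1 / 5 : ℝ) ^ L₃ - (1 / 5 : ℝ) ^ L₄)
        ≤ (1 - (1 / 5 : ℝ) ^ L₀ - (1 / 5 : ℝ) ^ L₁) * 1 := mul_le_mul_of_nonneg_left hB1 hA0.le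
      _ < 1 := by linarith
  have hCD : (16 / 25 : ℝ) ≤ (1 - (1 / 5 : ℝ) ^ L₀) * (1 - (1 / 5 : ℝ) ^ L₄) := by nlinarith
  nlinarith [mul_le_mul b2 hCD (by norm_num) (zpow_pos hq0 L₂).le]

/-- **EXACTLY-ONE CHAMBER.**  If `L₀, L₁, L₃, L₄ > 0 > L₂` (slope signs `+ + − + +`; by `x ↦ 1/x` also `− − + − −`) the unit `6 × 6` design has
EXACTLY ONE positive determinant zero (it lies in `(1/5, 1)`). [this file] -/
theorem card_posRoots_unit_six_eq_one_of_dip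
    (h0 : 0 < (2 * f 0 : ℤ) - d 0 - d 1) (h1 : 0 < (2 * f 1 : ℤ) - d 1 - d 2) (h2 : (2 * f 2 : ℤ) - d 2 - d 3 < 0)
    (h3 : 0 < (2 * f 3 : ℤ) - d 3 - d 4) (h4 : 0 < (2 * f 4 : ℤ) - d 4 - d 5) :
    ((pathDet (fun _ => (1 : ℝ)) d (fun _ => (1 : ℝ)) f 6).roots.toFinset.filter (fun x => 0 < x)).card = 1 := by
  set P := pathDet (fun _ => (1 : ℝ)) d (fun _ => (1 : ℝ)) f 6 with hP
  set S := P.roots.toFinset.filter (fun x => 0 < x) with hS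
  -- existence: a zero in `(1/5, 1)` by the intermediate value theorem
  have hneg := unit_six_dip_eval_fifth_neg d f h0 h1 h2 h3 h4
  have hpos : 0 < P.eval 1 := by rw [hP, eval_unit_six_one]; exact one_pos
  have hcont : ContinuousOn (fun x => P.eval x) (Set.Icc (1 / 5 : ℝ) 1) := P.continuous.continuousOn
  obtain ⟨r, ⟨hr1, hr2⟩, hr⟩ := intermediate_value_Ioo (show (1 / 5 : ℝ) ≤ 1 by norm_num) hcont ⟨hneg, hpos⟩
  have hrS : r ∈ S := by
    simp only [hS, Finset.mem_filter, Multiset.mem_toFinset, mem_roots', IsRoot.def]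
    exact ⟨⟨unit_six_ne_zero d f, hr⟩, by linarith⟩
  -- uniqueness
  have hle : S.card ≤ 1 := Finset.card_le_one.2 fun x hx y hy => by
    obtain ⟨hx0, hxr⟩ := mem_posRoots_unit_six d f hx
    obtain ⟨hy0, hyr⟩ := mem_posRoots_unit_six d f hy
    have hx1 := unit_six_root_lt_one_of_outer_pos_middle_neg d f h0 h4 h2 hx0 hxr
    have hy1 := unit_six_root_lt_one_of_outer_pos_middle_neg d f h0 h4 h2 hy0 hyr
    by_contra hne
    rcases lt_or_gt_of_ne hne with hlt | hgt
    · exact unit_six_dip_aux _ _ _ _ _ h0 h1 h2 h3 h4 hx0 hlt hy1 (unit_six_root_eq d f hx0 hxr) (unit_six_root_eq d f hy0 hyr)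
    · exact unit_six_dip_aux _ _ _ _ _ h0 h1 h2 h3 h4 hy0 hgt hx1 (unit_six_root_eq d f hy0 hyr) (unit_six_root_eq d f hx0 hxr)
  have hge : 1 ≤ S.card := Finset.card_pos.2 ⟨r, hrS⟩
  omega

end StaticTridiagonalRealUnit
end Summit.ValiantsHypothesis.ValiantsHypothesis.Theorems.KPlusLogSqLaw
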